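/-
Copyright (c) 2026 the pub-hodgecm-mathlib formalisation cell (harness21).  Prover seat hodgecm-mathlib-K2E1-p15 (g3), Track B ∕ K2-LIT, h413 = `stmt-HodgeConjecture-24833`,
R90-TF section S8 «ContSpec-n½» (planner R90-CS-plan (g0), item S8B#7b of `SOCKET-PLAN.v1.1`): a file-independent Hilbert-space support lemma for file B `R90_S8_ResidualSpectrumU3B`.
-/
import Literature.NumberTheory.Automorphic.HilbertRepSpectrum   -- ★ `ContRepresentation.ClosedSubrep` (closed invariant subspaces, `toSubmodule`, the order)
import HarnessLib

/-!
# S8B#7b — `R90S8OrthoLeft`: inside an orthogonal sum `A ⊕ B` of closed subrepresentations, a closed subrepresentation orthogonal to `B` lies in `A`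

Track B ∕ K2-LIT, crux h413 = `stmt-HodgeConjecture-24833`, route of record `HCCMUnconditional`; cell `hodgecm-mathlib`, R90-TF programme, section S8
«ContSpec-n½» (§13.9 residual spectrum), support lemma S8B#7b of the S8 socket plan (signature = the planner's probe `S8B7-signatures.probe.lean`, verbatim).
THEOREMS ONLY (no `def`, no `instance`, no `notation`, no named-fact hypothesis, no `sorry`; default heartbeats); lane `--supports stmt-HodgeConjecture-24833 --as helper`
(count-neutral).

THE MATHEMATICS (elementary Hilbert-space geometry; [Dixmier1977, §13.1.2] for the vocabulary of closed subrepresentations).  Let `π` be a representation of `G` on a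
complex inner-product space `H` and `A, B, P` closed `π`-invariant subspaces with `A ⟂ B`, `P ≤ A + B` (algebraic sum) and `P ⟂ B`.  For `p ∈ P` write `p = a + b`
(`a ∈ A`, `b ∈ B`); then `‖b‖² = ⟪p − a, b⟫ = ⟪p, b⟫ − ⟪a, b⟫ = 0`, so `b = 0` and `p = a ∈ A`.  Hence `P ≤ A`.  (Used in file B to place an irreducible summand of the
residual spectrum that is orthogonal to the one-dimensional part inside its complement.)
* §1 **`le_left_of_isOrtho_right`** — THE HEAD (S8B#7b).
HONEST LABEL: HC_CM is proved only modulo the 7 printed citations (2 remaining named inputs: hLiu418 = `stmt-HodgeConjecture-24832`, h413 = `stmt-HodgeConjecture-24833`) until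
rung 0 closes; this file asserts no named fact and closes no socket; count-neutral.

## References
* [Dixmier1977] J. Dixmier, *C\*-algebras* (North-Holland, 1977), §13.1.2 (sub-representations, orthogonal decompositions).
-/

set_option autoImplicit false
set_option linter.dupNamespace false  -- the mandated namespace `…HodgeConjecture.HodgeConjecture.R90.S8` (LEAD #1 L1) repeats the summit's segment

noncomputable section

open scoped InnerProductSpace

namespace Summit.HodgeConjecture.HodgeConjecture.R90.S8

open ContRepresentation

variable {G H : Type*} [Group G] [NormedAddCommGroup H] [InnerProductSpace ℂ H]
  {π : ContRepresentation ℂ G H}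

/-! ## §1 The head: `P ≤ A ⊔ B`, `P ⟂ B`, `A ⟂ B` ⟹ `P ≤ A` -/

/-- **S8B#7b.** Inside an orthogonal sum `A ⊕ B` of closed subrepresentations (`A ⟂ B`), a closed subrepresentation `P ≤ A ⊔ B` that is orthogonal to `B`
lies in `A`: writing `p = a + b`, `‖b‖² = ⟪p, b⟫ − ⟪a, b⟫ = 0`.  Elementary Hilbert-space geometry over Mathlib's `Submodule.IsOrtho` ∕ `Submodule.mem_sup`
and ★ `ContRepresentation.ClosedSubrep` [cite: Dixmier1977, §13.1.2]. -/
theorem le_left_of_isOrtho_right (A B P : ClosedSubrep π)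
    (hAB : A.toSubmodule ⟂ B.toSubmodule) (hle : P.toSubmodule ≤ A.toSubmodule ⊔ B.toSubmodule)
    (hPB : P.toSubmodule ⟂ B.toSubmodule) : P ≤ A := by
  rw [← ClosedSubrep.toSubmodule_le_iff]
  intro p hp
  obtain ⟨a, ha, b, hb, hab⟩ := Submodule.mem_sup.mp (hle hp)
  have hab' : b = p - a := by rw [← hab, add_sub_cancel_left]
  have hbb : ⟪b, b⟫_ℂ = 0 := by
    have h : ⟪p, b⟫_ℂ - ⟪a, b⟫_ℂ = ⟪b, b⟫_ℂ := by rw [← inner_sub_left, ← hab']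
    rw [← h, hPB.inner_eq hp hb, hAB.inner_eq ha hb, sub_zero]
  have hb0 : b = 0 := inner_self_eq_zero.mp hbb
  rw [hb0, add_zero] at hab
  exact hab ▸ ha

end Summit.HodgeConjecture.HodgeConjecture.R90.S8

end
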